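import Summits.ABC.ABC.Theses.IUTThetaPilot
import HarnessLib

set_option linter.dupNamespace false

/-!
# Route `route-ABC-IUTThetaPilot`, assembly item `Assembly` (stmt-ABC-19681) — CLOSED by the route's
# deciding theorem

The route file `Summits/ABC/ABC/Theses/IUTThetaPilot.lean` (abc-iut-plan gen 5, 2026-08-25) declares the
assembly item

  `Assembly : Prop := ThetaPartII → GenEllTwo → JInvWlog → _root_.ABC`

and proves, as its planner-authored DECIDING THEOREM `closes (hII : ThetaPartII) (hG : GenEllTwo)
(hW : JInvWlog) : _root_.ABC`, exactly this implication — pure logic over landed theorems of campaign S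
(`Cor22.exists_corollary22_of_partI_partII`, `Cor22.partI_holds`, `Cor22.abcCompactlyBounded_two_of_corollary22`,
`GenEll.abc_of_vojtaP1Deg`; [IUTchIV] Cor. 2.2 ⟹ Cor. 2.3 ⟹ [GenEll] Thm 2.1 ⟹ abc, S. Mochizuki,
*Inter-universal Teichmüller theory IV*, §2, and *Arithmetic elliptic curves in general position*, §2). This
file records the assembly item as a theorem of the `Theorems` side, literally the route decl, by invoking
`closes`. HONEST FRAMING: this is the COMPOSITION only; the crux `ThetaPartII` ([IUTchIV] Cor. 2.2 (ii),
uniform — inside `IUTDisputedClaim`) and the support `GenEllTwo` ([GenEll] Thm 2.1 at `Σ = {2}`,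
formalisation debt) remain OPEN hypotheses; nothing here asserts abc or takes a side on [IUTchIII] Cor. 3.12.
-/

namespace Summit.ABC.ABC.Theorems

/-- **stmt-ABC-19681 `Assembly`** (route-ABC-IUTThetaPilot, rank 1): `ThetaPartII → GenEllTwo → JInvWlog →
ABC` — the route's deciding theorem `Summit.ABC.ABC.Theses.IUTThetaPilot.closes`, restated as the proof of
the assembly item's decl. [cite: Mochizuki2012, IUTchIV Cor. 2.2–2.3 pp.41–46] -/
theorem Assembly_proof : Summit.ABC.ABC.Theses.IUTThetaPilot.Assembly := by
  unfold Summit.ABC.ABC.Theses.IUTThetaPilot.Assembly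
  exact fun hII hG hW => Summit.ABC.ABC.Theses.IUTThetaPilot.closes hII hG hW

end Summit.ABC.ABC.Theorems
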